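import Literature.NumberTheory.Automorphic.RankinSelbergLocalEpsilonProofs
import HarnessLib

/-!
# `RankinSelbergLocal`: the corrected statement of `hasRSEpsilon_ne_zero`

Topic `Literature/NumberTheory/Automorphic`. The named fact
`Literature.NumberTheory.Automorphic.hasRSEpsilon_ne_zero` of `RankinSelbergLocal.lean`
("the constant `e = ε(0, π × π', ψ)` of the local Rankin–Selberg `ε`-factor is non-zero";
Jacquet–Piatetski-Shapiro–Shalika 1983, Thm. 2.7 (iii); Cogdell, *Analytic theory of
`L`-functions for `GL_n`*, §3.1, Thm. 3.2 and the monomial `ε = c q^{-fs}`) is **mis-stated as a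
`Prop` family**: it is an M5 mechanical rewrite `theorem … := sorry` ↦ `def … : Prop := ∀ …`,
and a `def` abstracts only the section variables its body uses, so the standing instances of
its section — `[BorelSpace (GL_m ⧸ U_m)]`, `[SMulInvariantMeasure GL_m (GL_m ⧸ U_m) ν]`,
`[IsFiniteMeasureOnCompacts ν]`, `[ν.IsOpenPosMeasure]`, `[BorelSpace F]`, `[μ.IsAddHaarMeasure]`
(lines 708–723 of that file: "`ν` the `GL_m(F)`-invariant measure", "`μ` additive Haar") — were
silently dropped (`#check @hasRSEpsilon_ne_zero` ends
`… {ν : Measure (GL (Fin m) F ⧸ _)} [MeasurableSpace F] {μ : Measure F} : Prop`). Read at an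
arbitrary measure the `Prop` is false: at `μ = 0` (`1 ≤ m`, `2 ≤ n - m`) the tilde integrals
`Ψ_{n-m-1}` vanish identically, the functional equation holds with `γ = 0`, and `(0, a)` is
`ε`-data for every `a` (`not_hasRSEpsilon_ne_zero_measure_zero`,
`hasRSEpsilon_zero_measure_zero` of `RankinSelbergLocalEpsilonProofs`, given the `L`-factor
statements of JPSS Thm. 2.7 (i)–(ii) at `ν` and a central character of `π'`); the sibling facts
`existsUnique_hasRSLFactor`, `existsUnique_hasRSGamma`, `hasRSLFactor_of_isSatakeParameter`,
`existsUnique_hasRSEpsilon` lost the same binders and fail at `ν = 0`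
(`not_hasRSLFactor_zero_measure`, `not_hasRSEpsilon_zero_measure` of
`RankinSelbergLocalUniqueness`). So no closed proof `hasRSEpsilon_ne_zero_holds` can exist.

This file vendors the **corrected statement** `hasRSEpsilon_ne_zero_haar` — the same body with
the six standing instances restored as binders OF THE DEF (the pattern of
`Literature.AlgebraicGeometry.Motives.finite_deRhamCohomology_of_compact`), so that the family can
only be instantiated at an invariant Radon `ν` and a Haar `μ`, where, by JPSS Thm. 2.7, it is
true — together with the (proved) bookkeeping: at such measures it IS the old `Prop`
(`hasRSEpsilon_ne_zero_haar_iff`, definitional), and the two reductions of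
`RankinSelbergLocalEpsilonProofs` restated for it (`…_of_existsUnique_hasRSEpsilon`,
`…_of_tilde_span`). The old def is kept verbatim and has no dependents (only prose mentions in
`LocalLanglandsGL.lean`). What remains for a discharge is unchanged and is a theory of its own:
the `Ψ_{n-m-1}` integrals of the irreducible admissible generic twists `π ∘ ᵗ(·)⁻¹`, `π' ∘ ᵗ(·)⁻¹`
span a non-zero fractional ideal (JPSS Thm. 2.7 (ii), `j = n - m - 1`; convergence and
rationality of `p`-adic integrals of Whittaker functions).

## References

* H. Jacquet, I. I. Piatetski-Shapiro, J. A. Shalika, *Rankin–Selberg convolutions*, Amer. J.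
  Math. 105 (1983) 367–464, doi:10.2307/2374264, Thm. 2.7 (iii). [JacquetPiatetskiShapiroShalika1983]
* J. W. Cogdell, *Analytic theory of `L`-functions for `GL_n`*, in Bernstein–Gelbart (eds.),
  *An Introduction to the Langlands Program*, §3.1, Thm. 3.1–3.2. [CogdellAnalyticTheory2004]
-/

open MeasureTheory Polynomial

noncomputable section

namespace Literature.NumberTheory.Automorphic

section Corrected

variable {F : Type*} [Field F] [ValuativeRel F] [TopologicalSpace F]
  [IsNonarchimedeanLocalField F] {n m : ℕ}
  {V : Type*} [AddCommGroup V] [Module ℂ V] {V' : Type*} [AddCommGroup V'] [Module ℂ V']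

/-- **Non-vanishing of the constant of `ε(s, π × π', ψ)`, corrected statement**
(Jacquet–Piatetski-Shapiro–Shalika 1983, Thm. 2.7 (iii): `ε(s, π × π', ψ)` is a unit
`e q^{-as}` of `ℂ[q^{-s}, q^{s}]`, i.e. `e ≠ 0` — "applying the functional equation twice";
Cogdell, *Analytic theory of `L`-functions for `GL_n`*, §3.1, Thm. 3.2 and the monomial
`ε = c q^{-fs}`). For `F` non-archimedean local, `m < n`, irreducible admissible `π` of `GL_n(F)`
(`ψ`-generic) and `π'` of `GL_m(F)` (`ψ⁻¹`-generic), `ψ` non-trivial continuous, `ν` a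
`GL_m(F)`-invariant Borel measure on `GL_m(F) ⧸ U_m`, finite on compacts and positive on opens,
and `μ` an additive Haar measure on `F` (used in `Ψ_{n-m-1}`): if `(e, a)` are `ε`-data
(`HasRSEpsilon`, i.e. `L`-polynomials of `(π, π')`, `(π̃, π̃')` and the functional equation with
`γ = e T^a · L(1-s, π̃ × π̃') / L(s, π × π')`), then `e ≠ 0`. This CORRECTS
`Literature.NumberTheory.Automorphic.hasRSEpsilon_ne_zero`, whose `def` dropped the six measure
instances (binders of the def here; same body otherwise, `hasRSEpsilon_ne_zero_haar_iff`) and is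
false at `μ = 0` (`not_hasRSEpsilon_ne_zero_measure_zero`); see the module docstring.
[cite: JacquetPiatetskiShapiroShalika1983, Thm. 2.7 (iii)] -/
def hasRSEpsilon_ne_zero_haar (hmn : m < n) (π : Representation ℂ (GL (Fin n) F) V)
    (π' : Representation ℂ (GL (Fin m) F) V') (ψ : AddChar F Circle)
    [MeasurableSpace (GL (Fin m) F ⧸ upperUnitriangular (Fin m) F)]
    [BorelSpace (GL (Fin m) F ⧸ upperUnitriangular (Fin m) F)]
    (ν : Measure (GL (Fin m) F ⧸ upperUnitriangular (Fin m) F))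
    [SMulInvariantMeasure (GL (Fin m) F) (GL (Fin m) F ⧸ upperUnitriangular (Fin m) F) ν]
    [IsFiniteMeasureOnCompacts ν] [ν.IsOpenPosMeasure]
    [MeasurableSpace F] [BorelSpace F] (μ : Measure F) [μ.IsAddHaarMeasure] : Prop :=
  ∀ [π.IsIrreducible] [π'.IsIrreducible] (_hπ : π.IsAdmissible) (_hπ' : π'.IsAdmissible)
    (_hg : IsGeneric π ψ) (_hg' : IsGeneric π' ψ⁻¹) (_hψ : ψ.IsContinuousNontrivial)
    {e : ℂ} {a : ℤ} (_h : HasRSEpsilon hmn π π' ψ μ ν e a), e ≠ 0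

variable (hmn : m < n) (π : Representation ℂ (GL (Fin n) F) V)
  (π' : Representation ℂ (GL (Fin m) F) V') (ψ : AddChar F Circle)
  [MeasurableSpace (GL (Fin m) F ⧸ upperUnitriangular (Fin m) F)]
  [BorelSpace (GL (Fin m) F ⧸ upperUnitriangular (Fin m) F)]
  (ν : Measure (GL (Fin m) F ⧸ upperUnitriangular (Fin m) F))
  [SMulInvariantMeasure (GL (Fin m) F) (GL (Fin m) F ⧸ upperUnitriangular (Fin m) F) ν]
  [IsFiniteMeasureOnCompacts ν] [ν.IsOpenPosMeasure]
  [MeasurableSpace F] [BorelSpace F] (μ : Measure F) [μ.IsAddHaarMeasure]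

/-- At an invariant Radon `ν` and a Haar `μ` the corrected fact *is* the old `Prop`
`hasRSEpsilon_ne_zero` (same body), so the proofs files about the latter serve it unchanged. [folklore] -/
theorem hasRSEpsilon_ne_zero_haar_iff :
    hasRSEpsilon_ne_zero_haar hmn π π' ψ ν μ ↔
      hasRSEpsilon_ne_zero (hmn := hmn) (π := π) (π' := π') (ψ := ψ) (ν := ν) (μ := μ) :=
  Iff.rfl

/-- The corrected fact from uniqueness of `ε`-data (`existsUnique_hasRSEpsilon` at the same
measures; `hasRSEpsilon_ne_zero_of_existsUnique_hasRSEpsilon`). [cite: JacquetPiatetskiShapiroShalika1983, Thm. 2.7 (iii)] -/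
theorem hasRSEpsilon_ne_zero_haar_of_existsUnique_hasRSEpsilon
    (huniq : existsUnique_hasRSEpsilon hmn π π' ψ ν μ) :
    hasRSEpsilon_ne_zero_haar hmn π π' ψ ν μ :=
  (hasRSEpsilon_ne_zero_haar_iff hmn π π' ψ ν μ).mpr
    (hasRSEpsilon_ne_zero_of_existsUnique_hasRSEpsilon huniq)

/-- The corrected fact from the tilde span (JPSS 1983, Thm. 2.7 (ii) at `j = n - m - 1`,
transported along `W ↦ ρ(w_{n,m}) W̃`; `hasRSEpsilon_ne_zero_of_tilde_span`). This is the
remaining analytic input for a discharge. [cite: JacquetPiatetskiShapiroShalika1983, Thm. 2.7 (ii)–(iii)] -/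
theorem hasRSEpsilon_ne_zero_haar_of_tilde_span
    (hspan : ∀ [π.IsIrreducible] [π'.IsIrreducible], π.IsAdmissible → π'.IsAdmissible →
      IsGeneric π ψ → IsGeneric π' ψ⁻¹ → ψ.IsContinuousNontrivial →
      ∃ (P : ℂ[X]) (k : ℕ) (Λ : Fin k → Module.Dual ℂ V) (Λ' : Fin k → Module.Dual ℂ V')
        (v : Fin k → V) (v' : Fin k → V') (Q : Fin k → RatFunc ℂ),
        P.eval 0 ≠ 0 ∧ (∀ i, Λ i ∈ whittakerFunctionals π ψ) ∧
        (∀ i, Λ' i ∈ whittakerFunctionals π' ψ⁻¹) ∧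
        EqOnRightHalfPlane (GaloisRepresentations.IsNonarchimedeanLocalField.residueFieldCard F)
          (fun s => ∑ i,
            evalAtQ (GaloisRepresentations.IsNonarchimedeanLocalField.residueFieldCard F) (Q i) s *
            rsZetaTilde hmn μ ν
              (fun g => tildeFn (whittakerModel π (Λ i) (v i)) (g * weylNM F hmn.le))
              (tildeFn (whittakerModel π' (Λ' i) (v' i))) s)
          (rsLRat P)) :
    hasRSEpsilon_ne_zero_haar hmn π π' ψ ν μ :=
  (hasRSEpsilon_ne_zero_haar_iff hmn π π' ψ ν μ).mpr (hasRSEpsilon_ne_zero_of_tilde_span hspan)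

end Corrected

end Literature.NumberTheory.Automorphic
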